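import Mathlib
import Summits.Ventures.HodgeRepro.Tier3BranchSigns

/-!
# Tier3SplitFamilySigns — (R1) along the family at a split `𝔭`: the algebra of PERIOD.md §5(D), with the
`v ∤ 𝔭` clause REPAIRED (T3.5 for T3.1; PERIOD.md §5(D), §6 rows «(R1)» / «(R2)»)

Blind re-derivation cell `pub-hodge-repro`, seat `t3-p1` (Tier 3, T3.5 Lean item beside T3.1). Target tree path
`lean/Summits/Ventures/HodgeRepro/Tier3SplitFamilySigns.lean`; Mathlib + the cell's `Tier3BranchSigns` (t3-p3's
odd-order lemmas are CITED, not restated); theorems only (no definition, instance, notation or macro).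

`proofs/t3-p1/PERIOD.md` §5(D) («(R1) along the family, in print, without BHTY Lemma 4.11») argues that the
global root number of `χ_j′ x` equals that of `χ_j′` for every `x ∈ Ξ_𝔭` (`𝔭 = 𝔭₁𝔭₂` split in `K`, `p` odd):

> «For `ν ∈ Ξ_𝔭` (unramified outside `𝔭`, `p`-power order) the local root numbers of `χ_j′ν` at `v ∤ 𝔭` are those
> of `χ_j′`, and at the split pair `ε(½, χ_{𝔭₁}ν_{𝔭₁}, ψ)·ε(½, χ_{𝔭₂}ν_{𝔭₂}, ψ) = (χν)_{𝔭₁}(−1) = χ_{𝔭₁}(−1)`: here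
> `χ_{𝔭₂} = χ_{𝔭₁}^{-1}` because `χ_j′|_{k_v^×} = ε_v = 1` on the diagonal `k_v^× ⊂ K_v^× = k_v^× × k_v^×`, Tate's
> `ε(s,χ,ψ)ε(1−s,χ^{-1},ψ) = χ(−1)` … is applied at `s = ½`, and `ν_{𝔭₁}(−1) = 1` (an element of `p`-power order with
> square 1, `p` odd). So the global root number of `χ_j′x` is that of `χ_j′` for EVERY `x ∈ Ξ_𝔭`.»

PRECISION (this gen's own-eyes census; PERIOD-ADDENDUM-13): the first clause is not exact at the finitely many
finite `v ∤ 𝔭` dividing the conductor-different `𝔣_j 𝔡` — there the unramified twist `ν_v` multiplies the local root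
number by `ν_v(ϖ_v)^{a(χ_v) + n(ψ_v)}` (Tate; t3-p3's R2-PINNING-ADDENDUM-2 §A14(a) writes it), and the PRODUCT of
these factors over all `v ∤ 𝔭` is `ν` evaluated at the idele of `𝔣_j 𝔡`. The conclusion of §5(D) stands, by one more
line: `𝔣_j 𝔡` is stable under complex conjugation `c` and `ν` is anticyclotomic (`ν ∘ c = ν⁻¹`), so `ν(𝔣_j 𝔡)² = 1`,
and an odd-order `ν` takes the value `1` there. This file is the algebra of the REPAIRED computation, one theorem per
sentence; every arithmetic input is a hypothesis named for the printed fact it stands for: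

* `apply_inr_eq_inv`, `comp_inr_eq_inv_comp_inl`, `apply_eq_mul_inv` — «`χ_{𝔭₂} = χ_{𝔭₁}^{-1}` because … trivial on
  the diagonal»: a character of `A × A` (the split `K_𝔭^× = k_𝔭^× × k_𝔭^×`) trivial on the diagonal has its second
  component inverse to the first;
* `pair_product_eq` — «at the split pair `ε(…)·ε(…) = χ_{𝔭₁}(−1)`»: with Tate's relation at the centre
  `ε(ψ) ε(ψ⁻¹) = ψ(t)` (`t` = the image of `−1`, `t² = 1`) as the hypothesis `hTate`, the product of the two split local
  root numbers of a diagonal-trivial `χ` is `χ(t, 1)`;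
* `pair_product_mul_eq` — «`(χν)_{𝔭₁}(−1) = χ_{𝔭₁}(−1)`, `ν_{𝔭₁}(−1) = 1`»: the pair product is unchanged by a
  diagonal-trivial twist `ν` of odd order (t3-p3's `map_eq_one_of_odd_pow_eq_one`, cited);
* `map_eq_prod_mulSingle` — the missing factor as a product over places: `ν(a) = ∏_v ν_v(a_v)` for an idele `a`
  (`ν_v := ν ∘ Pi.mulSingle v`) — the idele of `𝔣_j 𝔡` carries `a_v = ϖ_v^{a(χ_v)+n(ψ_v)}`;
* `sq_eq_one_of_anticyclotomic_of_fixed`, `eq_one_of_anticyclotomic_of_fixed_of_odd` — the repair: `ν ∘ c = ν⁻¹`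
  and `c a = a` give `ν(a)² = 1`; odd order then gives `ν(a) = 1` (t3-p3's `eq_one_of_sq_eq_one_of_odd_pow_eq_one`,
  cited);
* `prod_eq_of_pair_of_prod_eq_one` — the assembly of the global root number as a finite product over places: if the
  twisted local factors are `u_v · w_v` off the split pair, the pair product is unchanged, and `∏ u_v = 1` over the
  other places, the total is unchanged;
* `prod_eq_of_pair_of_anticyclotomic` — the whole of §5(D) repaired, in one statement: places `ι` (finite), local
  groups `A v`, `ν` a character of the idele group `∀ v, A v` with `ν ∘ c = ν⁻¹` and `ν ^ n = 1` (`n` odd), an idele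
  `a` fixed by `c` and trivial at the two split places, local root numbers `w` (of `χ_j′`) and `w'` (of `χ_j′ ν`) with
  `w' v = ν (Pi.mulSingle v (a v)) * w v` off the pair and `w' p₁ * w' p₂ = w p₁ * w p₂` at the pair ⇒
  `∏ v, w' v = ∏ v, w v`: «the global root number of `χ_j′x` is that of `χ_j′` for EVERY `x ∈ Ξ_𝔭`»;
* `setOf_eq_one_and_eq` — the last sentence, «`S_j = {x : L(½, χ_j′x) ≠ 0}`»: a constant sign `+1` along the family
  removes the sign clause from `S_j := {x : ε(χ_j′x) = +1 ∧ L(½, χ_j′x) ≠ 0}`.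

What stays on the page (not in this file): that the global root number IS the product of the local ones, Tate's
functional equation of the local `ε`-factors (`hTate`), the unramified-twist formula `ε(χ_vν_v) = ν_v(ϖ_v)^{a+n}ε(χ_v)`
(the shape of `hout`), that `𝔣_j 𝔡` is `c`-stable (`χ_j′ ∘ c = χ_j′⁻¹` for a conjugate-symplectic character, `𝔡` the
different) and that `ν ∈ Ξ_𝔭` is anticyclotomic of odd order — PERIOD.md §5(B)/(D) and t3-p3's §A14(a)/(b). Nothing
here is about `L`-values; no verdict of route/TIER3.md §3 moves ((R1) stays FREE, as stated). HC_CM is NOT proved by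
anyone in this repository.
-/

set_option autoImplicit false

namespace HodgeRepro.T3P1.SplitFamilySigns

section SplitPair

variable {A M : Type*} [CommGroup A] [CommGroup M]

/-- A character of `A × A` trivial on the diagonal takes inverse values on the two axes:
`χ (1, a) = (χ (a, 1))⁻¹` (PERIOD.md §5(D): «`χ_{𝔭₂} = χ_{𝔭₁}^{-1}` because `χ_j′|_{k_v^×} = ε_v = 1` on the
diagonal `k_v^× ⊂ K_v^× = k_v^× × k_v^×`»). -/
theorem apply_inr_eq_inv (χ : A × A →* M) (hdiag : ∀ a : A, χ (a, a) = 1) (a : A) :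
    χ (1, a) = (χ (a, 1))⁻¹ := by
  have h : χ (a, 1) * χ (1, a) = 1 := by
    rw [← map_mul, Prod.mk_mul_mk, mul_one, one_mul]
    exact hdiag a
  exact eq_inv_of_mul_eq_one_right h

/-- The same, as characters of `A`: the second component of a diagonal-trivial `χ` is the inverse of the first
(`χ_{𝔭₂} = χ_{𝔭₁}^{-1}`). -/
theorem comp_inr_eq_inv_comp_inl (χ : A × A →* M) (hdiag : ∀ a : A, χ (a, a) = 1) :
    χ.comp (MonoidHom.inr A A) = (χ.comp (MonoidHom.inl A A))⁻¹ := by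
  ext a
  rw [MonoidHom.inv_apply, MonoidHom.comp_apply, MonoidHom.comp_apply, MonoidHom.inr_apply,
    MonoidHom.inl_apply]
  exact apply_inr_eq_inv χ hdiag a

/-- A diagonal-trivial character of `A × A` is determined by its first component:
`χ (x, y) = χ (x, 1) * (χ (y, 1))⁻¹`. -/
theorem apply_eq_mul_inv (χ : A × A →* M) (hdiag : ∀ a : A, χ (a, a) = 1) (x y : A) :
    χ (x, y) = χ (x, 1) * (χ (y, 1))⁻¹ := by
  rw [← apply_inr_eq_inv χ hdiag y, ← map_mul, Prod.mk_mul_mk, mul_one, one_mul]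

/-- **The split-pair product.** With Tate's relation at the centre, `ε ψ * ε ψ⁻¹ = ψ t` for every character `ψ`
of `A` (`t` the image of `−1`), the product of the two split local root numbers of a diagonal-trivial `χ` is
`χ (t, 1)` (PERIOD.md §5(D): «at the split pair `ε(½, χ_{𝔭₁}ν_{𝔭₁}, ψ)·ε(½, χ_{𝔭₂}ν_{𝔭₂}, ψ) = (χν)_{𝔭₁}(−1)`»,
applied to `χν` and to `χ`). -/
theorem pair_product_eq (ε : (A →* M) → M) (t : A) (hTate : ∀ ψ : A →* M, ε ψ * ε ψ⁻¹ = ψ t)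
    (χ : A × A →* M) (hdiag : ∀ a : A, χ (a, a) = 1) :
    ε (χ.comp (MonoidHom.inl A A)) * ε (χ.comp (MonoidHom.inr A A)) = χ (t, 1) := by
  rw [comp_inr_eq_inv_comp_inl χ hdiag, hTate, MonoidHom.comp_apply, MonoidHom.inl_apply]

/-- A diagonal-trivial twist of odd order does not move the split-pair product: «`(χν)_{𝔭₁}(−1) = χ_{𝔭₁}(−1)`
… `ν_{𝔭₁}(−1) = 1` (an element of `p`-power order with square 1, `p` odd)». The odd-order step is t3-p3's
`map_eq_one_of_odd_pow_eq_one` (Tier3BranchSigns), applied to `(t, 1)` with `t² = 1`. -/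
theorem pair_product_mul_eq (ε : (A →* M) → M) (t : A) (hTate : ∀ ψ : A →* M, ε ψ * ε ψ⁻¹ = ψ t)
    (ht : t ^ 2 = 1) (χ ν : A × A →* M) (hχ : ∀ a : A, χ (a, a) = 1) (hν : ∀ a : A, ν (a, a) = 1)
    {n : ℕ} (hn : Odd n) (hνn : ν ^ n = 1) :
    ε ((χ * ν).comp (MonoidHom.inl A A)) * ε ((χ * ν).comp (MonoidHom.inr A A)) =
      ε (χ.comp (MonoidHom.inl A A)) * ε (χ.comp (MonoidHom.inr A A)) := by
  have hχν : ∀ a : A, (χ * ν) (a, a) = 1 := fun a => by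
    rw [MonoidHom.mul_apply, hχ a, hν a, mul_one]
  have ht' : ((t, 1) : A × A) ^ 2 = 1 := by
    rw [Prod.pow_mk, ht, one_pow]
    rfl
  rw [pair_product_eq ε t hTate (χ * ν) hχν, pair_product_eq ε t hTate χ hχ, MonoidHom.mul_apply,
    Summit.Ventures.HodgeRepro.T3.R2Pinning.map_eq_one_of_odd_pow_eq_one ν hn hνn ht', mul_one]

end SplitPair

section IdeleFactor

variable {ι : Type*} [Fintype ι] [DecidableEq ι] {A : ι → Type*} [∀ v, CommGroup (A v)]
  {M : Type*} [CommGroup M]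

/-- A character of the idele group `∀ v, A v` evaluated at an idele `a` is the product of its local values
`ν_v (a_v)`, `ν_v := ν ∘ Pi.mulSingle v` — the factor «`∏_{v ∤ 𝔭} ν_v(ϖ_v)^{a(χ_v)+n(ψ_v)}`» of the repaired §5(D)
is `ν` at the idele of `𝔣_j 𝔡`. -/
theorem map_eq_prod_mulSingle (ν : (∀ v, A v) →* M) (a : ∀ v, A v) :
    ν a = ∏ v, ν (Pi.mulSingle v (a v)) := by
  conv_lhs => rw [← Finset.univ_prod_mulSingle a]
  exact map_prod ν _ _

end IdeleFactor

section Anticyclotomic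

variable {G M : Type*} [CommGroup G] [CommGroup M]

/-- An anticyclotomic character (`ν (c x) = (ν x)⁻¹` for the conjugation `c`) squares to `1` on any `c`-fixed
element: «`𝔣_j 𝔡` is `c`-stable and `ν` is anticyclotomic, so `ν(𝔣_j 𝔡)² = 1`». -/
theorem sq_eq_one_of_anticyclotomic_of_fixed (ν : G →* M) (c : G → G)
    (hanti : ∀ x, ν (c x) = (ν x)⁻¹) {a : G} (ha : c a = a) : (ν a) ^ 2 = 1 := by
  have h : ν a = (ν a)⁻¹ := by rw [← hanti a, ha]
  rw [sq]
  nth_rewrite 2 [h]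
  exact mul_inv_cancel (ν a)

/-- … and an anticyclotomic character of ODD order is `1` on every `c`-fixed element — the repair of §5(D)'s
`v ∤ 𝔭` clause: the missing factor `ν(𝔣_j 𝔡)` is `1` (t3-p3's `eq_one_of_sq_eq_one_of_odd_pow_eq_one`, cited). -/
theorem eq_one_of_anticyclotomic_of_fixed_of_odd (ν : G →* M) (c : G → G)
    (hanti : ∀ x, ν (c x) = (ν x)⁻¹) {a : G} (ha : c a = a) {n : ℕ} (hn : Odd n) (hνn : ν ^ n = 1) :
    ν a = 1 := by
  have hpow : (ν a) ^ n = 1 := by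
    rw [← MonoidHom.pow_apply, hνn, MonoidHom.one_apply]
  exact Summit.Ventures.HodgeRepro.T3.R2Pinning.eq_one_of_sq_eq_one_of_odd_pow_eq_one
    (sq_eq_one_of_anticyclotomic_of_fixed ν c hanti ha) hn hpow

end Anticyclotomic

section Assembly

variable {ι : Type*} [DecidableEq ι] {M : Type*} [CommGroup M]

/-- **Assembly over the places.** The global root number is the product over a finite set `S` of places; if the
twisted local factors are `w' v = u v * w v` at every `v ∈ S` off the split pair `{p₁, p₂} ⊆ S`, the pair product
is unchanged, and `∏ u = 1` over `S \ {p₁, p₂}`, then the total is unchanged. -/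
theorem prod_eq_of_pair_of_prod_eq_one (S : Finset ι) {p₁ p₂ : ι} (hp : p₁ ≠ p₂) (h₁ : p₁ ∈ S)
    (h₂ : p₂ ∈ S) (w w' u : ι → M) (hout : ∀ v ∈ S, v ≠ p₁ → v ≠ p₂ → w' v = u v * w v)
    (hpair : w' p₁ * w' p₂ = w p₁ * w p₂) (hu : ∏ v ∈ (S.erase p₁).erase p₂, u v = 1) :
    ∏ v ∈ S, w' v = ∏ v ∈ S, w v := by
  have h₂' : p₂ ∈ S.erase p₁ := Finset.mem_erase.mpr ⟨hp.symm, h₂⟩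
  rw [← Finset.mul_prod_erase S w' h₁, ← Finset.mul_prod_erase (S.erase p₁) w' h₂',
    ← Finset.mul_prod_erase S w h₁, ← Finset.mul_prod_erase (S.erase p₁) w h₂', ← mul_assoc,
    ← mul_assoc, hpair]
  congr 1
  have hrest : ∀ v ∈ (S.erase p₁).erase p₂, w' v = u v * w v := by
    intro v hv
    rw [Finset.mem_erase, Finset.mem_erase] at hv
    exact hout v hv.2.2 hv.2.1 hv.1
  rw [Finset.prod_congr rfl hrest, Finset.prod_mul_distrib, hu, one_mul]

end Assembly

section Family

variable {ι : Type*} [Fintype ι] [DecidableEq ι] {A : ι → Type*} [∀ v, CommGroup (A v)]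
  {M : Type*} [CommGroup M]

/-- The product of the local values `ν_v (a_v)` over the places off the split pair is `ν a`, for an idele `a`
trivial at `p₁` and `p₂`. -/
theorem prod_erase_erase_mulSingle_eq (ν : (∀ v, A v) →* M) (a : ∀ v, A v) {p₁ p₂ : ι}
    (ha₁ : a p₁ = 1) (ha₂ : a p₂ = 1) :
    ∏ v ∈ (Finset.univ.erase p₁).erase p₂, ν (Pi.mulSingle v (a v)) = ν a := by
  rw [Finset.prod_erase _ (by rw [ha₂, Pi.mulSingle_one, map_one]),
    Finset.prod_erase _ (by rw [ha₁, Pi.mulSingle_one, map_one]), map_eq_prod_mulSingle]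

/-- **§5(D) repaired, in one statement — «the global root number of `χ_j′x` is that of `χ_j′` for EVERY
`x ∈ Ξ_𝔭`».** Places `ι` (finite), local groups `A v`, the idele group `∀ v, A v`; `ν` a character of it with
`ν ∘ c = ν⁻¹` (anticyclotomic) and `ν ^ n = 1` (`n` odd: `p`-power order, `p` odd); `a` an idele with `c a = a`
(the idele of the `c`-stable `𝔣_j 𝔡`), trivial at the two split places `p₁ ≠ p₂`; `w v` the local root numbers of
`χ_j′`, `w' v` those of `χ_j′ ν`, related by `w' v = ν_v (a_v) * w v` off the pair (the unramified-twist formula,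
`ν_v(ϖ_v)^{a(χ_v)+n(ψ_v)} = ν (Pi.mulSingle v (a v))`) and by the split-pair identity (`pair_product_mul_eq`) at the
pair. Then the global root numbers agree: `∏ v, w' v = ∏ v, w v`. -/
theorem prod_eq_of_pair_of_anticyclotomic (ν : (∀ v, A v) →* M) (c : (∀ v, A v) → (∀ v, A v))
    (hanti : ∀ x, ν (c x) = (ν x)⁻¹) {n : ℕ} (hn : Odd n) (hνn : ν ^ n = 1) (a : ∀ v, A v)
    (ha : c a = a) {p₁ p₂ : ι} (hp : p₁ ≠ p₂) (ha₁ : a p₁ = 1) (ha₂ : a p₂ = 1) (w w' : ι → M)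
    (hout : ∀ v, v ≠ p₁ → v ≠ p₂ → w' v = ν (Pi.mulSingle v (a v)) * w v)
    (hpair : w' p₁ * w' p₂ = w p₁ * w p₂) :
    ∏ v, w' v = ∏ v, w v :=
  prod_eq_of_pair_of_prod_eq_one Finset.univ hp (Finset.mem_univ p₁) (Finset.mem_univ p₂) w w'
    (fun v => ν (Pi.mulSingle v (a v))) (fun v _ hv₁ hv₂ => hout v hv₁ hv₂) hpair
    (by
      rw [prod_erase_erase_mulSingle_eq ν a ha₁ ha₂]
      exact eq_one_of_anticyclotomic_of_fixed_of_odd ν c hanti ha hn hνn)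

end Family

section NonvanishingSet

variable {X M : Type*} [One M]

/-- «So … `S_j = {x : L(½, χ_j′x) ≠ 0}`»: when the sign is `+1` along the whole family, the sign clause of
`S_j := {x : ε(χ_j′x) = +1 ∧ L(½, χ_j′x) ≠ 0}` is void. -/
theorem setOf_eq_one_and_eq (ε : X → M) (P : X → Prop) (h : ∀ x, ε x = 1) :
    {x | ε x = 1 ∧ P x} = {x | P x} := by
  ext x
  simp only [Set.mem_setOf_eq, h x, true_and]

end NonvanishingSet

end HodgeRepro.T3P1.SplitFamilySigns
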